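import Summits.Ventures.CertifiedQuantumChemistry.Certificates.HubbardRingL4SectorDQGDualFamily
import HarnessLib

/-!
# Ventures/CertifiedQuantumChemistry — Certificates/HubbardRingL4SectorDQGDualCheckR1.lean: the order-`1` coefficient identity of the rational part of the
# explicit finite-`U` dual certificate family for the `(2,2)`-SECTOR (level-DQG) programme of the Hubbard 4-ring over `ℚ(√2)` (one kernel `decide`)

HONEST FRAMING (verbatim): certified bounds for a stated model Hamiltonian in a stated basis; not a claim about the real molecule beyond that model. A kernel identity for an AUXILIARY dual object; no model value, no row, no claim node.

Seat rdm-B (gen 45). `(dualR 1).check = true`: the canonical `Γ`-, `γ`- and constant defects of the order-`1` record of the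
rational part vanish (`DualL4.Dual.check`, `Certificates/HubbardRingL4SectorDual.lean`), i.e. the rational part of the coefficient of `ε^1` of the
Lagrangian identity `Σ doublons − 2ε·Σ bonds − mu(ε) = Σ_j ⟨Z_j(ε), B_j(γ, Γ)⟩ + Σ_rows mult(ε)·row` holds on every Hermitian,
pair-antisymmetric, `S_z`-diagonal `(γ, Γ)`. Offline the same identity was checked in exact arithmetic (`tools/x14-g45/dual4dqg/exactify_joint.py`).
0 sorry, 0 def; standard axioms.
-/

namespace Summit.Ventures.CertifiedQuantumChemistry

namespace DualL4.SectorDQG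

/-- **Order `1` of the rational part passes the check** (kernel evaluation on the literal tables). -/
theorem checkR1 : (dualR 1).check = true := by
  decide +kernel

end DualL4.SectorDQG

end Summit.Ventures.CertifiedQuantumChemistry
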